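import Summits.RiemannHypothesis.RiemannHypothesis.Theorems.PlantedLiBlindnessLow

/-!
# W-06 cycle 7 «DETECTION COST ATLAS» — PLANTED LI, the SEEING side (C6⁷ `sees_L`, rh-idea-4 g15)

(RE-POINT (CA137), desk rh-split-ref g21 2026-08-29: the ONE import now names `Theorems/PlantedLiBlindnessLow.lean` = part (ii) of
the re-cut slot (4b), which carries the §4 lemmas used below — `re_pow_eq_norm_pow_mul_cos`, `arcsin_le_of_small`,
`one_sub_inv_rho'_re/_im` — and imports part (i) `Theorems/PlantedLiBlindness.lean` (`blindL_holds`, `liCoshDefect_le_low`,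
`norm_one_sub_inv_rho_le_one`); the one former use of (4b)'s `le_arcsin_of_nonneg` (dropped there as a restatement of a tree lemma) is
inlined in `hθ_ge`; nothing else in this file changed versus the desk cut b44f3c06574a2a48 · 345.)

PRE-CUT rev b (rh-idea-4 g15, 2026-08-29; = rev a 9a88d1ab779f31ee + §S1 «RH-free instance below height 1000», nothing else changed): candidate lane file AFTER the desk cuts (4a) `Theorems/PlantedLi.lean`
(defs of record, ns `RhIdea4.G14.W06C67`) and (4b) `Theorems/PlantedLiBlindness.lean` (rh-idea-6 g15, ns
`RhIdea6.G15.C47b`, `blindL_holds : BlindL`).  It cannot be farm-checked before (4a)/(4b) are in the tree; its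
self-contained replay is rh-idea-4's Sketch rev 2.2 `pub/ideators/rh-idea-4/c7/Sketch-W06c7-C6-LiJensenCost-rh-idea-4-g15-rev22.lean`
(farm rc 0, 0 sorry; `#print axioms seesL_holds` = propext, Classical.choice, Quot.sound), from which every block
below is copied VERBATIM (§S0 of the Sketch = the seven lemmas of (4b) it uses, here reached by `open RhIdea6.G15.C47b`).

CONTENT.  `liSeesDegree` (the CORRECTED upper closed form `d_L = (‖ρ‖²/δ)(L′ + 2 log L′ + 3)`, `‖ρ‖² = (½+δ)²+γ²`,
`L′ = log(‖ρ‖²/δ)`), `SeesL`, and `seesL_holds : SeesL` — under `RiemannHypothesisUpTo T` (`T ≥ 1000`), `γ ≥ 100`,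
`0 < δ < ½`, `d_L ≤ T²`, the planted Li sequence `plantedLi γ δ` has a NEGATIVE term at some `900 ≤ n ≤ d_L(γ,δ)`;
with (4b)'s `blindL_holds` this is the two-sided LI cost law `li_cost : SeesL ∧ BlindL` (C6⁷ rev-2.1 stub `stub_li_cost`
discharged).  Mechanism: `λ_n ≤ (17/30) n log n` (tree law `liAsymptoticLawAllRange_holds`, `liC1 ≤ −2/3`);
`‖1 − 1/ρ′‖ⁿ ≥ exp(nδ/‖ρ‖²)`; phase `arg(1 − 1/ρ′) ∈ [0.99/γ, 1.001/γ]` returns to `cos ≥ 7/8` inside the last window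
`[d_L − 6.4γ − 2, d_L]`, where `exp(nδ/‖ρ‖²) ≥ 14·(‖ρ‖²/δ)·L′²` beats `(17/30) n log n + 6 ≤ 6.8·(‖ρ‖²/δ)·L′² + 6`.
READING (TEST 0): a statement about a PLANTED sequence with a KNOWN off-line pair; nothing here bears on the truth of RH.
-/

namespace RhIdea4.G14.W06C67

open Complex Literature.NumberTheory.LFunctions Literature.NumberTheory.DiophantineGeometry
open Summit.RiemannHypothesis.RiemannHypothesis.Theorems.LiTheory
open RhIdea6.G15.C47b

noncomputable section

/-- SEES-ABOVE closed form (upper law for the first sign change), rev 2.2 (CORRECTED, see the file ERRATUM):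
`d_L(γ,δ) = (‖ρ‖²/δ)·(L′ + 2·log L′ + 3)`, `‖ρ‖² = (½+δ)² + γ²`, `L′ = log(‖ρ‖²/δ)`.
(rev 2.1 had `(γ²/δ)(L + log L + 4)`: one `log L` short; ratio new/old ≈ 1.08 on the W-06-7 grid.) -/
def liSeesDegree (γ δ : ℝ) : ℝ :=
  ((1/2 + δ) ^ 2 + γ ^ 2) / δ *
    (Real.log (((1/2 + δ) ^ 2 + γ ^ 2) / δ) + 2 * Real.log (Real.log (((1/2 + δ) ^ 2 + γ ^ 2) / δ)) + 3)


/-- `sees_L`: given RH for `ζ` up to a height whose Li range covers `d_L`, the planted Li sequence has a NEGATIVE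
term at some `900 ≤ n ≤ d_L(γ,δ)`.  PROVED below (`seesL_holds`, rev 2.2). -/
def SeesL : Prop :=
  ∀ ⦃T γ δ : ℝ⦄, 1000 ≤ T → RiemannHypothesisUpTo T → 100 ≤ γ → 0 < δ → δ < 1/2 →
    liSeesDegree γ δ ≤ T ^ 2 →
    ∃ n : ℕ, 900 ≤ n ∧ (n : ℝ) ≤ liSeesDegree γ δ ∧ plantedLi γ δ n < 0


/-! ### §S — `sees_L` KERNEL (rev 2.2, rh-idea-4 g15) -/

/-- `liC1 = (γ_E − 1 − log 2π)/2 ≤ −2/3` (`γ_E < 2/3`, `log 2π ≥ 1`). -/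
theorem liC1_le : liC1 ≤ -(2 / 3 : ℝ) := by
  have hγ := Real.eulerMascheroniConstant_lt_two_thirds
  have hlog : 1 ≤ Real.log (2 * Real.pi) := by
    rw [Real.le_log_iff_exp_le (by positivity)]
    have he := Real.exp_one_lt_d9
    have hπ := Real.pi_gt_three
    linarith
  unfold liC1; linarith

/-- ζ side, UPPER: `λ_n ≤ (17/30)·n·log n` on `900 ≤ n ≤ T²` under `RiemannHypothesisUpTo T`, `T ≥ 1000`
(`λ_n ≤ liMainTerm n + 2√n log n + liCoshDefect ≤ (1/2 + 1/15) n log n − (2/3 − 0.000341) n`). -/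
theorem keiperLiCoeff_le_up {n : ℕ} {T : ℝ} (hT : 1000 ≤ T) (hRH : RiemannHypothesisUpTo T)
    (hn : 900 ≤ n) (hnT : (n : ℝ) ≤ T ^ 2) : keiperLiCoeff n ≤ 17 / 30 * n * Real.log n := by
  have hlaw := liAsymptoticLawAllRange_holds hT hRH hn
  have hdef := liCoshDefect_le_low hT hn hnT
  have hband := BudgetLog.band_le hn
  have hC := liC1_le
  have hn' : (900 : ℝ) ≤ n := by exact_mod_cast hn
  have hn0 : (0 : ℝ) ≤ n := by linarith
  have hlogn : 6 ≤ Real.log n := BudgetLog.six_le_log (by linarith)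
  have h2 := (abs_le.1 hlaw).2
  have hmain : liMainTerm n = (n : ℝ) / 2 * Real.log n + liC1 * n := rfl
  have hCn : liC1 * n ≤ -(2 / 3 : ℝ) * n := mul_le_mul_of_nonneg_right hC hn0
  rw [hmain] at h2
  linarith

/-- GROWTH of the exploding factor: `exp(n·δ/‖ρ‖²) ≤ ‖1 − 1/ρ′‖ⁿ`, `‖ρ‖² = (½+δ)² + γ²`
(`‖1 − 1/ρ′‖² = ‖ρ‖²/‖ρ′‖²` and `log x ≥ 1 − 1/x`). -/
theorem exp_le_norm_one_sub_inv_rho'_pow {γ δ : ℝ} (hγ : γ ≠ 0) (hδ : 0 ≤ δ) (n : ℕ) :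
    Real.exp ((n : ℝ) * δ / ((1/2 + δ) ^ 2 + γ ^ 2)) ≤ ‖1 - 1 / rho' γ δ‖ ^ n := by
  have hq : 0 < (1/2 - δ) ^ 2 + γ ^ 2 := by positivity
  have hq' : 0 < (1/2 + δ) ^ 2 + γ ^ 2 := by positivity
  have hX : ‖1 - 1 / rho' γ δ‖ ^ 2 = ((1/2 + δ) ^ 2 + γ ^ 2) / ((1/2 - δ) ^ 2 + γ ^ 2) := by
    rw [← Complex.normSq_eq_norm_sq, normSq_one_sub_inv_rho' γ δ hq.ne']
    congr 1 <;> ring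
  have hge1 : 1 ≤ ‖1 - 1 / rho' γ δ‖ := by
    have hsq : 1 ≤ ‖1 - 1 / rho' γ δ‖ ^ 2 := by
      rw [hX, le_div_iff₀ hq]; nlinarith
    nlinarith [norm_nonneg (1 - 1 / rho' γ δ)]
  have hpos : 0 < ‖1 - 1 / rho' γ δ‖ := by linarith
  have h1 := Real.one_sub_inv_le_log_of_pos (x := ‖1 - 1 / rho' γ δ‖ ^ 2) (by positivity)
  have h2 : 1 - (‖1 - 1 / rho' γ δ‖ ^ 2)⁻¹ = 2 * δ / ((1/2 + δ) ^ 2 + γ ^ 2) := by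
    rw [hX, inv_div]
    field_simp
    ring
  rw [h2, Real.log_pow] at h1
  push_cast at h1
  have h4 : δ / ((1/2 + δ) ^ 2 + γ ^ 2) ≤ Real.log ‖1 - 1 / rho' γ δ‖ := by
    rw [mul_div_assoc] at h1; linarith
  have h3 : (n : ℝ) * δ / ((1/2 + δ) ^ 2 + γ ^ 2) ≤ n * Real.log ‖1 - 1 / rho' γ δ‖ := by
    rw [mul_div_assoc]; exact mul_le_mul_of_nonneg_left h4 (Nat.cast_nonneg n)
  calc Real.exp ((n : ℝ) * δ / ((1/2 + δ) ^ 2 + γ ^ 2))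
      ≤ Real.exp (n * Real.log ‖1 - 1 / rho' γ δ‖) := Real.exp_le_exp.mpr h3
    _ = ‖1 - 1 / rho' γ δ‖ ^ n := by rw [Real.exp_nat_mul, Real.exp_log hpos]

/-- RESONANCE: a phase `0 < θ ≤ 1/2` returns within `θ` of `2πℤ` at an integer of every window
`[N₁, N₂]` with `N₂ ≥ N₁ + 2π/θ + 1`, and there `cos(nθ) ≥ 7/8`. -/
theorem exists_nat_cos_ge {θ N₁ N₂ : ℝ} (hθ : 0 < θ) (hθ1 : θ ≤ 1 / 2) (hN₁ : 0 ≤ N₁)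
    (hN : N₁ + 2 * Real.pi / θ + 1 ≤ N₂) :
    ∃ n : ℕ, N₁ ≤ n ∧ (n : ℝ) ≤ N₂ ∧ 7 / 8 ≤ Real.cos (n * θ) := by
  have hπ := Real.pi_pos
  have h2πθ : 0 < 2 * Real.pi / θ := by positivity
  have hN₂ : 0 ≤ N₂ := by linarith
  obtain ⟨k, hk_def⟩ : ∃ k : ℕ, k = ⌊N₂ * θ / (2 * Real.pi)⌋₊ := ⟨_, rfl⟩
  have hk_le : (k : ℝ) ≤ N₂ * θ / (2 * Real.pi) := by rw [hk_def]; exact Nat.floor_le (by positivity)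
  have hk_gt : N₂ * θ / (2 * Real.pi) < k + 1 := by rw [hk_def]; exact Nat.lt_floor_add_one _
  obtain ⟨y, hy_def⟩ : ∃ y : ℝ, y = 2 * Real.pi * k / θ := ⟨_, rfl⟩
  have hy_le : y ≤ N₂ := by
    rw [hy_def, div_le_iff₀ hθ]
    rw [le_div_iff₀ (by positivity)] at hk_le
    linarith
  have hy_gt : N₂ - 2 * Real.pi / θ < y := by
    rw [div_lt_iff₀ (by positivity)] at hk_gt
    have e : N₂ - 2 * Real.pi / θ = (N₂ * θ - 2 * Real.pi) / θ := by field_simp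
    rw [e, hy_def, div_lt_div_iff_of_pos_right hθ]
    linarith
  have hy0 : 0 ≤ y := by rw [hy_def]; positivity
  obtain ⟨n, hn_def⟩ : ∃ n : ℕ, n = ⌊y⌋₊ := ⟨_, rfl⟩
  have hn_le : (n : ℝ) ≤ y := by rw [hn_def]; exact Nat.floor_le hy0
  have hn_gt : y < n + 1 := by rw [hn_def]; exact Nat.lt_floor_add_one y
  refine ⟨n, by linarith, hn_le.trans hy_le, ?_⟩
  have hyθ : y * θ = k * (2 * Real.pi) := by rw [hy_def]; field_simp
  have hε0 : 0 ≤ (y - n) * θ := mul_nonneg (by linarith) hθ.le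
  have hε1 : (y - n) * θ ≤ 1 / 2 := by
    have : (y - n) * θ ≤ 1 * θ := mul_le_mul_of_nonneg_right (by linarith) hθ.le
    linarith
  have e : (n : ℝ) * θ = k * (2 * Real.pi) - (y - n) * θ := by rw [← hyθ]; ring
  rw [e, Real.cos_nat_mul_two_pi_sub]
  have hc := Real.one_sub_sq_div_two_le_cos (x := (y - n) * θ)
  nlinarith

/-- `e^{2.96} ≥ 14` (`e > 2.718`, `e^{0.96} ≥ 1.96`). -/
theorem fourteen_le_exp : (14 : ℝ) ≤ Real.exp 2.96 := by
  have e : Real.exp 2.96 = Real.exp 1 * Real.exp 1 * Real.exp 0.96 := by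
    rw [← Real.exp_add, ← Real.exp_add]; norm_num
  have h1 := Real.exp_one_gt_d9
  have h2 := Real.add_one_le_exp (0.96 : ℝ)
  have h3 : (7.38 : ℝ) ≤ Real.exp 1 * Real.exp 1 := by nlinarith
  rw [e]; nlinarith [Real.exp_pos (0.96 : ℝ)]

set_option maxHeartbeats 800000 in
/-- **`sees_L` (KERNEL, rev 2.2).**  Under `RiemannHypothesisUpTo T` (`T ≥ 1000`), `γ ≥ 100`, `0 < δ < ½` and
`d_L(γ,δ) ≤ T²`, the planted Li sequence has a negative term at some `900 ≤ n ≤ d_L(γ,δ)` — in fact in the last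
phase window `[d_L − 6.4γ − 2, d_L]`. -/
theorem seesL_holds : SeesL := by
  intro T γ δ hT hRH hγ hδ hδ' hDT
  have hγ0 : 0 < γ := by linarith
  have hγγ : 100 * γ ≤ γ ^ 2 := by nlinarith [mul_le_mul_of_nonneg_left hγ hγ0.le]
  have hδ2 : δ ^ 2 ≤ 1 / 4 := by nlinarith
  have hq : 0 < (1/2 - δ) ^ 2 + γ ^ 2 := by positivity
  obtain ⟨q', hq'_def⟩ : ∃ q' : ℝ, q' = (1/2 + δ) ^ 2 + γ ^ 2 := ⟨_, rfl⟩
  have hq'0 : 0 < q' := by rw [hq'_def]; positivity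
  have hq'le : q' ≤ γ ^ 2 + 1 := by rw [hq'_def]; nlinarith [hδ2]
  have hq'ge : γ ^ 2 ≤ q' := by rw [hq'_def]; linarith [sq_nonneg (1/2 + δ)]
  obtain ⟨A, hA_def⟩ : ∃ A : ℝ, A = q' / δ := ⟨_, rfl⟩
  have hAge : 2 * γ ^ 2 ≤ A := by
    rw [hA_def, le_div_iff₀ hδ]
    linarith [mul_le_mul_of_nonneg_left (show 2 * δ ≤ 1 by linarith) (sq_nonneg γ)]
  have hA1 : 1 ≤ A := by linarith
  have hA0 : 0 < A := by linarith
  obtain ⟨L, hL_def⟩ : ∃ L : ℝ, L = Real.log A := ⟨_, rfl⟩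
  have hL6 : 6 ≤ L := by rw [hL_def]; exact BudgetLog.six_le_log (by linarith)
  have hL0 : 0 < L := by linarith
  have hlogL : Real.log L ≤ L - 1 := Real.log_le_sub_one_of_pos hL0
  have hlogL0 : 0 ≤ Real.log L := Real.log_nonneg (by linarith)
  have hD : liSeesDegree γ δ = A * (L + 2 * Real.log L + 3) := by
    unfold liSeesDegree; rw [hL_def, hA_def, hq'_def]
  -- sizes of the degree D := liSeesDegree γ δ
  have hDle : liSeesDegree γ δ ≤ 4 * A * L := by
    rw [hD]
    linarith [mul_le_mul_of_nonneg_left hlogL hA0.le,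
      mul_le_mul_of_nonneg_left (show (1:ℝ) ≤ L by linarith) hA0.le]
  have hDge : 18 * γ ^ 2 ≤ liSeesDegree γ δ := by
    rw [hD]
    have h := mul_le_mul hAge (show (9:ℝ) ≤ L + 2 * Real.log L + 3 by linarith) (by norm_num) hA0.le
    linarith
  have hDδ : liSeesDegree γ δ * δ = q' * (L + 2 * Real.log L + 3) := by
    rw [hD, hA_def]; field_simp
  -- the growing factor z := 1 − 1/ρ′, its modulus and its phase θ
  obtain ⟨z, hz_def⟩ : ∃ z : ℂ, z = 1 - 1 / rho' γ δ := ⟨_, rfl⟩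
  have hre := one_sub_inv_rho'_re γ δ
  have him := one_sub_inv_rho'_im γ δ
  rw [← hz_def] at hre him
  have hre_pos : 0 < z.re := by
    rw [hre, sub_pos, div_lt_one hq]; linarith [sq_nonneg (1/2 - δ)]
  have hz0 : z ≠ 0 := fun h => by rw [h] at hre_pos; simp at hre_pos
  have him_pos : 0 < z.im := by rw [him]; positivity
  have hns : ‖z‖ ^ 2 = q' / ((1/2 - δ) ^ 2 + γ ^ 2) := by
    rw [← Complex.normSq_eq_norm_sq, hz_def, normSq_one_sub_inv_rho' γ δ hq.ne', hq'_def]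
    congr 1 <;> ring
  have hnorm_ge : 1 ≤ ‖z‖ := by
    have hsq : 1 ≤ ‖z‖ ^ 2 := by
      rw [hns, le_div_iff₀ hq, hq'_def]; linarith
    nlinarith [norm_nonneg z]
  have hnorm_le : ‖z‖ ≤ 1.00125 := by
    have hsq : ‖z‖ ^ 2 ≤ 1.0025 := by
      rw [hns, div_le_iff₀ hq, hq'_def]; linarith [sq_nonneg δ]
    nlinarith [norm_nonneg z]
  have hnpos : 0 < ‖z‖ := by linarith
  obtain ⟨t, ht_def⟩ : ∃ t : ℝ, t = z.im / ‖z‖ := ⟨_, rfl⟩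
  have ht0 : 0 ≤ t := by rw [ht_def]; positivity
  have ht_le : t ≤ 1 / γ := by
    have h1 : t ≤ z.im := by rw [ht_def]; exact div_le_self him_pos.le hnorm_ge
    have h2 : z.im ≤ 1 / γ := by
      rw [him, div_le_div_iff₀ hq hγ0]; linarith [sq_nonneg (1/2 - δ)]
    exact h1.trans h2
  have hγinv : 1 / γ ≤ 1 / 100 := by rw [div_le_div_iff₀ hγ0 (by norm_num)]; linarith
  have ht_ge : 0.99 / γ ≤ t := by
    rw [ht_def, div_le_div_iff₀ hγ0 hnpos]
    have h1 : 0.999 ≤ z.im * γ := by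
      rw [him, div_mul_eq_mul_div, le_div_iff₀ hq]; linarith [hδ2]
    linarith
  obtain ⟨θ, hθ_def⟩ : ∃ θ : ℝ, θ = Complex.arg z := ⟨_, rfl⟩
  have harg : θ = Real.arcsin t := by rw [hθ_def, ht_def]; exact Complex.arg_of_re_nonneg hre_pos.le
  have hθ_ge : 0.99 / γ ≤ θ := by
    have hta : t ≤ Real.arcsin t := by  -- was `le_arcsin_of_nonneg ht0 _` of slot (4b); inlined (desk re-cut (CA137))
      have h := Real.sin_le (Real.arcsin_nonneg.mpr ht0)
      rwa [Real.sin_arcsin (by linarith) (by linarith)] at h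
    rw [harg]; exact ht_ge.trans hta
  have hθ_le : θ ≤ 1.001 * (1 / γ) := by
    rw [harg]
    exact (arcsin_le_of_small ht0 (by linarith)).trans (mul_le_mul_of_nonneg_left ht_le (by norm_num))
  have hθ0 : 0 < θ := lt_of_lt_of_le (by positivity) hθ_ge
  have hθ1 : θ ≤ 1 / 2 := by linarith
  have hγθ : 0.99 ≤ θ * γ := by rwa [div_le_iff₀ hγ0] at hθ_ge
  have hwin : 2 * Real.pi / θ ≤ 6.4 * γ := by
    rw [div_le_iff₀ hθ0]
    have hπ := Real.pi_lt_d2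
    linarith
  -- an integer n in the last window [D − 6.4γ − 2, D] with cos(nθ) ≥ 7/8
  obtain ⟨n, hn1, hn2, hcos⟩ := exists_nat_cos_ge hθ0 hθ1
    (N₁ := liSeesDegree γ δ - 6.4 * γ - 2) (N₂ := liSeesDegree γ δ) (by linarith) (by linarith)
  have hn900 : (900 : ℝ) ≤ n := by linarith
  have hn900' : 900 ≤ n := by exact_mod_cast hn900
  have hn0 : (0 : ℝ) < n := by linarith
  have hnT : (n : ℝ) ≤ T ^ 2 := hn2.trans hDT
  refine ⟨n, hn900', hn2, ?_⟩
  -- ζ side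
  have hlam := keiperLiCoeff_le_up hT hRH hn900' hnT
  have hlogn0 : 0 ≤ Real.log n := Real.log_nonneg (by linarith)
  have hlogn : Real.log n ≤ 3 * L := by
    have h1 : Real.log n ≤ Real.log (4 * A * L) := Real.log_le_log hn0 (hn2.trans hDle)
    have h2 : Real.log (4 * A * L) = Real.log 4 + Real.log A + Real.log L := by
      rw [Real.log_mul (by positivity) hL0.ne', Real.log_mul (by norm_num) hA0.ne']
    have h4 : Real.log 4 ≤ 3 := (Real.log_le_sub_one_of_pos (by norm_num)).trans (by norm_num)
    rw [h2, ← hL_def] at h1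
    linarith
  have hnlogn : (n : ℝ) * Real.log n ≤ 12 * (A * L ^ 2) := by
    have h := mul_le_mul (hn2.trans hDle) hlogn hlogn0 (by positivity)
    linarith [h]
  -- planted side: the decaying factor contributes ≥ −1, the growing one ≥ (7/8)·‖z‖ⁿ ≥ (7/8)·14·A·L²
  have hdec : -1 ≤ ((1 - 1 / rho γ δ) ^ n).re := by
    have h1 := Complex.abs_re_le_norm ((1 - 1 / rho γ δ) ^ n)
    have h2 : ‖(1 - 1 / rho γ δ) ^ n‖ ≤ 1 := by
      rw [norm_pow]; exact pow_le_one₀ (norm_nonneg _) (norm_one_sub_inv_rho_le_one hδ.le hγ0.ne')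
    have h3 := (abs_le.1 (h1.trans h2)).1
    linarith
  have hpolar : (z ^ n).re = ‖z‖ ^ n * Real.cos (n * θ) := by
    rw [hθ_def]; exact re_pow_eq_norm_pow_mul_cos hz0 n
  have hgrow : Real.exp (n * δ / q') ≤ ‖z‖ ^ n := by
    have h := exp_le_norm_one_sub_inv_rho'_pow (δ := δ) hγ0.ne' hδ.le n
    rw [← hq'_def, ← hz_def] at h
    exact h
  have hexp_ge : L + 2 * Real.log L + 2.96 ≤ n * δ / q' := by
    rw [le_div_iff₀ hq'0]
    have h1 : (6.4 * γ + 2) * δ ≤ 0.04 * q' := by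
      have : (6.4 * γ + 2) * δ ≤ (6.4 * γ + 2) * (1 / 2) := mul_le_mul_of_nonneg_left hδ'.le (by positivity)
      linarith
    have h2 : (liSeesDegree γ δ - 6.4 * γ - 2) * δ ≤ n * δ := mul_le_mul_of_nonneg_right hn1 hδ.le
    linarith [h1, h2, hDδ]
  have hbig : 14 * (A * L ^ 2) ≤ ‖z‖ ^ n := by
    have eL : Real.exp L = A := by rw [hL_def, Real.exp_log hA0]
    have e2 : Real.exp (2 * Real.log L) = L ^ 2 := by
      rw [show (2:ℝ) * Real.log L = Real.log L + Real.log L by ring, Real.exp_add, Real.exp_log hL0]; ring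
    have e3 : Real.exp (L + 2 * Real.log L + 2.96) = A * L ^ 2 * Real.exp 2.96 := by
      rw [Real.exp_add, Real.exp_add, eL, e2]
    have h1 : Real.exp (L + 2 * Real.log L + 2.96) ≤ ‖z‖ ^ n := (Real.exp_le_exp.mpr hexp_ge).trans hgrow
    rw [e3] at h1
    have h14 := fourteen_le_exp
    linarith [mul_le_mul_of_nonneg_left h14 (by positivity : (0:ℝ) ≤ A * L ^ 2)]
  have hzc : ‖z‖ ^ n * (7 / 8) ≤ ‖z‖ ^ n * Real.cos (n * θ) :=
    mul_le_mul_of_nonneg_left hcos (pow_nonneg (norm_nonneg z) n)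
  have hAL : 1 ≤ A * L ^ 2 := by
    have hL2 : (1:ℝ) ≤ L ^ 2 := by nlinarith
    have := mul_le_mul hA1 hL2 (by norm_num) hA0.le
    linarith
  -- assemble
  unfold plantedLi plantedLiTerm
  rw [← hz_def, Complex.add_re, hpolar]
  linarith [hlam, hdec, hzc, hbig, hnlogn, hAL]

/-! ### §S1 — an RH-FREE instance (rev 2.3, pure addition): the tree's `riemannHypothesisUpTo_1000` discharges the
height hypothesis whenever `d_L(γ,δ) ≤ 10⁶`. -/

/-- Crude size of the seeing degree: `404 ≤ ‖ρ‖²/δ ≤ B ≤ e¹¹ ⟹ d_L(γ,δ) ≤ 34·B` (`log ≤ 11`, `2 log log ≤ 20`). -/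
theorem liSeesDegree_le_of {γ δ B : ℝ} (hA1 : 404 ≤ ((1/2 + δ) ^ 2 + γ ^ 2) / δ)
    (hA : ((1/2 + δ) ^ 2 + γ ^ 2) / δ ≤ B) (hB : B ≤ Real.exp 11) : liSeesDegree γ δ ≤ B * 34 := by
  unfold liSeesDegree
  set A := ((1/2 + δ) ^ 2 + γ ^ 2) / δ with hA_def
  have hA0 : 0 < A := by linarith
  have hL6 : 6 ≤ Real.log A := BudgetLog.six_le_log hA1
  have hL : Real.log A ≤ 11 := by
    rw [Real.log_le_iff_le_exp hA0]; exact hA.trans hB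
  have hLL : Real.log (Real.log A) ≤ 10 := (Real.log_le_sub_one_of_pos (by linarith)).trans (by linarith)
  have h34 : Real.log A + 2 * Real.log (Real.log A) + 3 ≤ 34 := by linarith
  exact mul_le_mul hA h34 (by linarith [Real.log_nonneg (show (1:ℝ) ≤ Real.log A by linarith)]) (by linarith)

/-- `e¹¹ ≥ 22 225` (`e ≥ 2.718`, `2.718¹¹ = 59 775.9…`). -/
theorem exp_eleven_ge : (22225 : ℝ) ≤ Real.exp 11 := by
  have h1 : (2.718 : ℝ) ≤ Real.exp 1 := le_of_lt (lt_trans (by norm_num) Real.exp_one_gt_d9)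
  have h2 := pow_le_pow_left₀ (by norm_num : (0:ℝ) ≤ 2.718) h1 11
  have h3 : Real.exp 1 ^ 11 = Real.exp 11 := by rw [← Real.exp_nat_mul]; norm_num
  have h4 : (22225 : ℝ) ≤ 2.718 ^ 11 := by norm_num
  rw [h3] at h2; linarith

/-- **`sees_L` below the verified height 1000 (RH-FREE, KERNEL)**: `γ ≥ 100`, `0 < δ < ½`, `d_L(γ,δ) ≤ 10⁶ ⟹` the planted
Li sequence has a negative term at some `900 ≤ n ≤ d_L(γ,δ)` — by the tree's `riemannHypothesisUpTo_1000`. -/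
theorem seesL_height1000 {γ δ : ℝ} (hγ : 100 ≤ γ) (hδ : 0 < δ) (hδ' : δ < 1 / 2)
    (hd : liSeesDegree γ δ ≤ 1000000) :
    ∃ n : ℕ, 900 ≤ n ∧ (n : ℝ) ≤ liSeesDegree γ δ ∧ plantedLi γ δ n < 0 :=
  seesL_holds (T := 1000) (by norm_num) riemannHypothesisUpTo_1000 hγ hδ hδ' (by norm_num; linarith)

/-- **ATLAS CELL (100, 0.45), RH-FREE KERNEL**: the planted Li sequence of the pair `½ ± 0.45 ± 100i` has a NEGATIVE term at
some `900 ≤ n ≤ 755 650` (`d_L(100, 0.45) ≤ 34·22 225`; the implicit law predicts the first one near `3.1·10⁵`,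
rh-idea-6's `blindL_height1000` gives positivity for `900 ≤ n ≤ b_L = 1.78·10⁵`). -/
theorem seesL_100_045 : ∃ n : ℕ, 900 ≤ n ∧ (n : ℝ) ≤ 755650 ∧ plantedLi 100 0.45 n < 0 := by
  have hD : liSeesDegree 100 0.45 ≤ 755650 := by
    have h := liSeesDegree_le_of (γ := 100) (δ := 0.45) (B := 22225) (by norm_num) (by norm_num) exp_eleven_ge
    linarith
  obtain ⟨n, h1, h2, h3⟩ :=
    seesL_height1000 (γ := 100) (δ := 0.45) (by norm_num) (by norm_num) (by norm_num) (by linarith)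
  exact ⟨n, h1, h2.trans hD, h3⟩

/-- **The two-sided LI cost law of C6⁷** (rev-2.1 stub `stub_li_cost` discharged): `sees_L ∧ blind_L`. -/
theorem li_cost : SeesL ∧ BlindL := ⟨seesL_holds, blindL_holds⟩

end

end RhIdea4.G14.W06C67
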